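import Mathlib.Algebra.Module.ZLattice.Covolume
import Mathlib.MeasureTheory.Measure.Haar.InnerProductSpace
import Mathlib.Analysis.InnerProductSpace.PiL2
import Literature.Algebra.EuclideanLattices.DualLattice
import Literature.Algebra.EuclideanLattices.GaussTernaryForm
import Literature.Algebra.EuclideanLattices.ReducedBasis3D
import HarnessLib

/-!
# Gauss's theorem: `γ₃ = 2^{1/3}` — minimum, determinant and short dual vectors of lattices in `ℝ³`

Topic: `Literature/Algebra/EuclideanLattices`.

## The result, as printed

Cassels, *An Introduction to the Geometry of Numbers*, Ch. II §3.4, Theorem III (after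
Gauss 1831): for a positive definite ternary form there is an integral `u ≠ o` with
`f(u) ≤ (2D)^{1/3}`; for a reduced form `f₁₁f₂₂f₃₃ ≤ 2D`; equality only for forms equivalent to
a multiple of `x₁² + x₂² + x₃² + x₂x₃ + x₃x₁ + x₁x₂` (the face-centred cubic lattice). In lattice
language (Conway–Sloane, *SPLAG*, Ch. 1 §1.4 and Table 1.2): the Hermite constant is
`γ₃ = 2^{1/3}`, i.e. `λ₁(L)⁶ ≤ 2 covol(L)²` for every full lattice `L ⊂ ℝ³`, with equality
exactly for the fcc lattice `A₃ ≅ D₃`, whose dual is the bcc lattice `A₃*` of (rescaled) minimal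
norm `3/(2λ₁(L))·…` — concretely, for an extremal `L` the dual basis vectors have
`‖bᵢ*‖² covol(L)² = λ₁² · λ₁² - (λ₁²/2)² = ¾ λ₁(L)⁴`.

## What is here

For a full lattice `L` (a `Submodule ℤ` with `DiscreteTopology`, `IsZLattice ℝ`) of
`EuclideanSpace ℝ (Fin 3)` with its Lebesgue measure:

* `IsMinkowskiReduced.prod_le_two_mul_det` — for a Minkowski-reduced generating triple
  `(u, v, w)` (file `ReducedBasis3D.lean`) the Gram matrix satisfies
  `‖u‖²‖v‖²‖w‖² ≤ 2 det Gram` (the reduction inequalities `‖v‖ ≤ ‖v ± u‖`, `‖w‖ ≤ ‖w ± u‖`,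
  `‖w‖ ≤ ‖w ± v‖`, `‖w‖ ≤ ‖w ± u ± v‖` are exactly the `ϑ, ψ, ω ≥ 0` of Cassels's proof, fed to
  `prod_le_two_mul_det_of_reduced` of `GaussTernaryForm.lean`), together with the first
  rigidity step (some `2|⟪·,·⟫|` equals `‖u‖²` in the extremal case); any inner product space.
* `det_gram_eq_covolume_sq` — `det Gram(u, v, w) = covol(L)²` for a generating triple.
* `pow_three_le_two_mul_covolume_sq` — **Gauss's theorem / `γ₃ ≤ 2^{1/3}`**: if every nonzero
  vector of `L` has `‖x‖² ≥ m ≥ 0` then `m³ ≤ 2 covol(L)²`.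
* `exists_mem_dualLattice_norm_sq_eq_of_extremal` — the rigidity consequence used by the
  crystallization barrier `NoUniversallyOptimalLattice3D`: if moreover `2 covol(L)² ≤ m³`
  (`m > 0`), then the dual lattice contains a nonzero `z` with `‖z‖² covol(L)² = ¾ m²`
  (a dual-basis vector `zᵢ = D⁻¹ ∑ⱼ Cᵢⱼ vⱼ`, `‖zᵢ‖² = Cᵢᵢ / D`, for a cofactor
  `Cᵢᵢ = m·m - (m/2)²`).

Not here: the full equivalence class statement of Theorem III.C, and `γ₃ ≥ 2^{1/3}` (attained
by fcc; the explicit fcc lattice lives with the barrier file).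

## References

* J. W. S. Cassels, *An Introduction to the Geometry of Numbers*, Springer, Ch. II §3.4,
  Theorem III (pp. 32–33), Ch. II §2.1 (reduction).
* J. H. Conway, N. J. A. Sloane, *Sphere Packings, Lattices and Groups*, 3rd ed., Ch. 1 §1.4,
  §1.5 (Hermite constant, `γ₃ = 2^{1/3}`, dual lattice).
-/

noncomputable section

open Module Submodule MeasureTheory
open scoped InnerProductSpace

namespace Literature.Algebra.EuclideanLattices

/-! ## Reduction inequalities in inner-product form and Gauss's inequality for the Gram matrix -/

section InnerProduct

variable {E : Type*} [NormedAddCommGroup E] [InnerProductSpace ℝ E]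

/-- If `‖x‖ ≤ ‖x + y‖` and `‖x‖ ≤ ‖x - y‖` then `2|⟪x, y⟫| ≤ ‖y‖²` (expand the squares; this
is how the reduction inequalities `f(e ± e') ≥ f(e)` become Cassels's `ϑ, ψ ≥ 0`).
[cite: Cassels1997, Ch. II §3.4 Theorem III] -/
theorem two_mul_abs_inner_le_of_norm_le {x y : E} (h₁ : ‖x‖ ≤ ‖x + y‖) (h₂ : ‖x‖ ≤ ‖x - y‖) :
    2 * |⟪x, y⟫_ℝ| ≤ ‖y‖ ^ 2 := by
  have h₁' : ‖x‖ ^ 2 ≤ ‖x + y‖ ^ 2 := pow_le_pow_left₀ (norm_nonneg _) h₁ 2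
  have h₂' : ‖x‖ ^ 2 ≤ ‖x - y‖ ^ 2 := pow_le_pow_left₀ (norm_nonneg _) h₂ 2
  rw [norm_add_sq_real] at h₁'
  rw [norm_sub_sq_real] at h₂'
  rcases le_total 0 ⟪x, y⟫_ℝ with h | h
  · rw [abs_of_nonneg h]; linarith
  · rw [abs_of_nonpos h]; linarith

namespace IsMinkowskiReduced

variable {L : Submodule ℤ E} {u v w : E}

/-- **Gauss's inequality for a Minkowski-reduced basis** (Cassels, Ch. II §3.4,
Theorem III.B): for a Minkowski-reduced generating triple `(u, v, w)` of `L`,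
`‖u‖² ‖v‖² ‖w‖² ≤ 2 det Gram(u, v, w)`; and (first step of III.C) if equality holds and
`‖u‖ = ‖w‖` then one of `2|⟪u, v⟫|, 2|⟪u, w⟫|, 2|⟪v, w⟫|` equals `‖u‖²`. The hypotheses of
`prod_le_two_mul_det_of_reduced` are the reduction inequalities `‖u‖ ≤ ‖v‖ ≤ ‖w‖`,
`‖v‖ ≤ ‖v ± u‖`, `‖w‖ ≤ ‖w ± u‖`, `‖w‖ ≤ ‖w ± v‖`, `‖w‖ ≤ ‖w ± u ± v‖`.
[cite: Cassels1997, Ch. II §3.4 Theorem III] -/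
theorem prod_le_two_mul_det (h : IsMinkowskiReduced L u v w) :
    ‖u‖ ^ 2 * ‖v‖ ^ 2 * ‖w‖ ^ 2 ≤
        2 * Matrix.det !![‖u‖ ^ 2, ⟪u, v⟫_ℝ, ⟪u, w⟫_ℝ; ⟪u, v⟫_ℝ, ‖v‖ ^ 2, ⟪v, w⟫_ℝ;
          ⟪u, w⟫_ℝ, ⟪v, w⟫_ℝ, ‖w‖ ^ 2] ∧
      (2 * Matrix.det !![‖u‖ ^ 2, ⟪u, v⟫_ℝ, ⟪u, w⟫_ℝ; ⟪u, v⟫_ℝ, ‖v‖ ^ 2, ⟪v, w⟫_ℝ;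
          ⟪u, w⟫_ℝ, ⟪v, w⟫_ℝ, ‖w‖ ^ 2] ≤ ‖u‖ ^ 2 * ‖v‖ ^ 2 * ‖w‖ ^ 2 →
        ‖u‖ ^ 2 = ‖w‖ ^ 2 →
        2 * |⟪u, v⟫_ℝ| = ‖u‖ ^ 2 ∨ 2 * |⟪u, w⟫_ℝ| = ‖u‖ ^ 2 ∨ 2 * |⟪v, w⟫_ℝ| = ‖u‖ ^ 2) := by
  -- ordering
  have h₁₂ : ‖u‖ ^ 2 ≤ ‖v‖ ^ 2 := pow_le_pow_left₀ (norm_nonneg _) h.norm_le₁₂ 2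
  have h₂₃ : ‖v‖ ^ 2 ≤ ‖w‖ ^ 2 := pow_le_pow_left₀ (norm_nonneg _) h.norm_le₂₃ 2
  -- ϑ / ψ inequalities
  have t₁₂ : 2 * |⟪u, v⟫_ℝ| ≤ ‖u‖ ^ 2 := by
    rw [real_inner_comm]
    refine two_mul_abs_inner_le_of_norm_le ?_ ?_
    · simpa using h.norm_le_add₂ 1 0
    · simpa [sub_eq_add_neg] using h.norm_le_add₂ (-1) 0
  have t₁₃ : 2 * |⟪u, w⟫_ℝ| ≤ ‖u‖ ^ 2 := by
    rw [real_inner_comm]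
    refine two_mul_abs_inner_le_of_norm_le ?_ ?_
    · simpa using h.norm_le_add₃ 1 0
    · simpa [sub_eq_add_neg] using h.norm_le_add₃ (-1) 0
  have t₂₃ : 2 * |⟪v, w⟫_ℝ| ≤ ‖v‖ ^ 2 := by
    rw [real_inner_comm]
    refine two_mul_abs_inner_le_of_norm_le ?_ ?_
    · simpa using h.norm_le_add₃ 0 1
    · simpa [sub_eq_add_neg] using h.norm_le_add₃ 0 (-1)
  -- ω inequalities: ‖w‖ ≤ ‖w + a u + b v‖, a, b = ±1
  have expand : ∀ a b : ℝ, ‖w + a • u + b • v‖ ^ 2 = ‖w‖ ^ 2 + a ^ 2 * ‖u‖ ^ 2 + b ^ 2 * ‖v‖ ^ 2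
      + 2 * a * ⟪w, u⟫_ℝ + 2 * b * ⟪w, v⟫_ℝ + 2 * (a * b) * ⟪u, v⟫_ℝ := by
    intro a b
    rw [norm_add_sq_real, norm_add_sq_real]
    simp only [inner_add_left, real_inner_smul_left, real_inner_smul_right, norm_smul, mul_pow,
      Real.norm_eq_abs, sq_abs]
    ring
  have ω : ∀ a b : ℤ, (a = 1 ∨ a = -1) → (b = 1 ∨ b = -1) → ‖w‖ ^ 2 ≤ ‖w‖ ^ 2 + ‖u‖ ^ 2
      + ‖v‖ ^ 2 + 2 * a * ⟪w, u⟫_ℝ + 2 * b * ⟪w, v⟫_ℝ + 2 * (a * b) * ⟪u, v⟫_ℝ := by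
    intro a b ha hb
    have key := pow_le_pow_left₀ (norm_nonneg _) (h.norm_le_add₃ a b) 2
    rw [← Int.cast_smul_eq_zsmul ℝ a, ← Int.cast_smul_eq_zsmul ℝ b, expand] at key
    have ha2 : ((a : ℝ)) ^ 2 = 1 := by rcases ha with rfl | rfl <;> norm_num
    have hb2 : ((b : ℝ)) ^ 2 = 1 := by rcases hb with rfl | rfl <;> norm_num
    rw [ha2, hb2] at key
    linarith
  have o₁ := ω 1 1 (Or.inl rfl) (Or.inl rfl)
  have o₂ := ω (-1) (-1) (Or.inr rfl) (Or.inr rfl)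
  have o₃ := ω 1 (-1) (Or.inl rfl) (Or.inr rfl)
  have o₄ := ω (-1) 1 (Or.inr rfl) (Or.inl rfl)
  push_cast at o₁ o₂ o₃ o₄
  rw [real_inner_comm u w, real_inner_comm v w] at o₁ o₂ o₃ o₄
  have H := prod_le_two_mul_det_of_reduced (f₁₂ := ⟪u, v⟫_ℝ) (f₁₃ := ⟪u, w⟫_ℝ) (f₂₃ := ⟪v, w⟫_ℝ)
    (sq_nonneg ‖u‖) h₁₂ h₂₃ t₁₂ t₁₃ t₂₃ (by linarith) (by linarith) (by linarith) (by linarith)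
  exact H

end IsMinkowskiReduced

/-- **A dual-basis vector from cofactors.** For a generating triple `(v₁, v₂, v₃)` of `L` with
Gram matrix `G` of nonzero determinant `D`, the vector `z = D⁻¹ (C₁₁ v₁ + C₁₂ v₂ + C₁₃ v₃)`
(`C₁ⱼ` the cofactors of the first row) satisfies `⟪z, v₁⟫ = 1`, `⟪z, v₂⟫ = ⟪z, v₃⟫ = 0`, hence
lies in the dual lattice `L*`, and `‖z‖² = C₁₁ / D` (the `(1,1)` entry of `G⁻¹`, the Gram
matrix of the dual basis; Conway–Sloane Ch. 1 §1.5 / Peikert 2016 §2.1, "the dual basis").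
[cite: ConwaySloane1999, Ch. 1 §1.5 (dual lattice and dual basis)] -/
theorem exists_mem_dualLattice_inner_eq_one (L : Submodule ℤ E) {v₁ v₂ v₃ : E}
    (hspan : span ℤ ({v₁, v₂, v₃} : Set E) = L)
    (hD : Matrix.det !![‖v₁‖ ^ 2, ⟪v₁, v₂⟫_ℝ, ⟪v₁, v₃⟫_ℝ; ⟪v₁, v₂⟫_ℝ, ‖v₂‖ ^ 2, ⟪v₂, v₃⟫_ℝ;
      ⟪v₁, v₃⟫_ℝ, ⟪v₂, v₃⟫_ℝ, ‖v₃‖ ^ 2] ≠ 0) :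
    ∃ z ∈ dualLattice L, ⟪z, v₁⟫_ℝ = 1 ∧
      ‖z‖ ^ 2 = (‖v₂‖ ^ 2 * ‖v₃‖ ^ 2 - ⟪v₂, v₃⟫_ℝ ^ 2) /
        Matrix.det !![‖v₁‖ ^ 2, ⟪v₁, v₂⟫_ℝ, ⟪v₁, v₃⟫_ℝ; ⟪v₁, v₂⟫_ℝ, ‖v₂‖ ^ 2, ⟪v₂, v₃⟫_ℝ;
          ⟪v₁, v₃⟫_ℝ, ⟪v₂, v₃⟫_ℝ, ‖v₃‖ ^ 2] := by
  rw [det_symm_fin_three] at hD ⊢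
  set N₁ := ‖v₁‖ ^ 2 with hN₁
  set N₂ := ‖v₂‖ ^ 2 with hN₂
  set N₃ := ‖v₃‖ ^ 2 with hN₃
  set f₁₂ := ⟪v₁, v₂⟫_ℝ with hf₁₂
  set f₁₃ := ⟪v₁, v₃⟫_ℝ with hf₁₃
  set f₂₃ := ⟪v₂, v₃⟫_ℝ with hf₂₃
  set D := N₁ * N₂ * N₃ + 2 * f₁₂ * f₁₃ * f₂₃ - N₁ * f₂₃ ^ 2 - N₂ * f₁₃ ^ 2 - N₃ * f₁₂ ^ 2
    with hDdef
  set C₁₁ := N₂ * N₃ - f₂₃ ^ 2 with hC₁₁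
  set C₁₂ := f₁₃ * f₂₃ - f₁₂ * N₃ with hC₁₂
  set C₁₃ := f₁₂ * f₂₃ - f₁₃ * N₂ with hC₁₃
  set z : E := D⁻¹ • (C₁₁ • v₁ + C₁₂ • v₂ + C₁₃ • v₃) with hz
  have i₁ : ⟪z, v₁⟫_ℝ = 1 := by
    have : ⟪z, v₁⟫_ℝ = D⁻¹ * (C₁₁ * N₁ + C₁₂ * f₁₂ + C₁₃ * f₁₃) := by
      rw [hz, real_inner_smul_left, inner_add_left, inner_add_left, real_inner_smul_left,
        real_inner_smul_left, real_inner_smul_left, real_inner_self_eq_norm_sq,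
        real_inner_comm v₁ v₂, real_inner_comm v₁ v₃]
    rw [this]
    have hnum : C₁₁ * N₁ + C₁₂ * f₁₂ + C₁₃ * f₁₃ = D := by
      simp only [hC₁₁, hC₁₂, hC₁₃, hDdef]; ring
    rw [hnum, inv_mul_cancel₀ hD]
  have i₂ : ⟪z, v₂⟫_ℝ = 0 := by
    have : ⟪z, v₂⟫_ℝ = D⁻¹ * (C₁₁ * f₁₂ + C₁₂ * N₂ + C₁₃ * f₂₃) := by
      rw [hz, real_inner_smul_left, inner_add_left, inner_add_left, real_inner_smul_left,
        real_inner_smul_left, real_inner_smul_left, real_inner_self_eq_norm_sq,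
        real_inner_comm v₂ v₃]
    rw [this]
    have hnum : C₁₁ * f₁₂ + C₁₂ * N₂ + C₁₃ * f₂₃ = 0 := by
      simp only [hC₁₁, hC₁₂, hC₁₃]; ring
    rw [hnum, mul_zero]
  have i₃ : ⟪z, v₃⟫_ℝ = 0 := by
    have : ⟪z, v₃⟫_ℝ = D⁻¹ * (C₁₁ * f₁₃ + C₁₂ * f₂₃ + C₁₃ * N₃) := by
      rw [hz, real_inner_smul_left, inner_add_left, inner_add_left, real_inner_smul_left,
        real_inner_smul_left, real_inner_smul_left, real_inner_self_eq_norm_sq]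
    rw [this]
    have hnum : C₁₁ * f₁₃ + C₁₂ * f₂₃ + C₁₃ * N₃ = 0 := by
      simp only [hC₁₁, hC₁₂, hC₁₃]; ring
    rw [hnum, mul_zero]
  refine ⟨z, ?_, i₁, ?_⟩
  · rw [mem_dualLattice]
    intro y hy
    rw [← hspan, mem_span_triple] at hy
    obtain ⟨a, b, c, rfl⟩ := hy
    refine ⟨a, ?_⟩
    rw [inner_add_right, inner_add_right, ← Int.cast_smul_eq_zsmul ℝ a,
      ← Int.cast_smul_eq_zsmul ℝ b, ← Int.cast_smul_eq_zsmul ℝ c, real_inner_smul_right,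
      real_inner_smul_right, real_inner_smul_right, i₁, i₂, i₃]
    ring
  · have : ‖z‖ ^ 2 = D⁻¹ * (C₁₁ * ⟪z, v₁⟫_ℝ + C₁₂ * ⟪z, v₂⟫_ℝ + C₁₃ * ⟪z, v₃⟫_ℝ) := by
      conv_lhs => rw [← real_inner_self_eq_norm_sq, hz]
      rw [real_inner_smul_right, inner_add_right, inner_add_right, real_inner_smul_right,
        real_inner_smul_right, real_inner_smul_right]
    rw [this, i₁, i₂, i₃, mul_one, mul_zero, mul_zero, add_zero, add_zero, div_eq_inv_mul]

end InnerProduct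

/-! ## Gram determinant and covolume in `ℝ³` -/

section Euclidean

/-- The covolume of the `ℤ`-span of a real basis of `ℝⁿ` is the absolute value of the
determinant of its coordinate matrix (Conway–Sloane Ch. 1 §1.4, "the determinant of the
lattice"; the `EuclideanSpace` form of Mathlib's `ZLattice.covolume_eq_det`).
[cite: ConwaySloane1999, Ch. 1 §1.4] -/
theorem covolume_span_eq_abs_det {n : ℕ} (b : Basis (Fin n) ℝ (EuclideanSpace ℝ (Fin n))) :
    ZLattice.covolume (span ℤ (Set.range b)) = |(Matrix.of fun i j => b i j).det| := by
  classical
  let b₀ := (EuclideanSpace.basisFun (Fin n) ℝ).toBasis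
  rw [ZLattice.covolume_eq_measure_fundamentalDomain _ _ (ZSpan.isAddFundamentalDomain b volume),
    ZSpan.measureReal_fundamentalDomain b volume b₀,
    measureReal_congr (ZSpan.fundamentalDomain_ae_parallelepiped b₀ volume)]
  have h1 : volume.real (parallelepiped b₀) = 1 := by
    simp [measureReal_def, b₀, OrthonormalBasis.volume_parallelepiped]
  rw [h1, mul_one, Basis.det_apply, ← Matrix.det_transpose]
  -- the two matrices agree definitionally: `b₀.toMatrix b i j = b j i`
  congr 2

/-- The range of `![u, v, w]` is `{u, v, w}`. [folklore] -/
theorem range_vec_three {α : Type*} (u v w : α) : Set.range ![u, v, w] = {u, v, w} := by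
  ext x
  simp only [Set.mem_range, Set.mem_insert_iff, Set.mem_singleton_iff]
  constructor
  · rintro ⟨i, rfl⟩
    fin_cases i <;> simp
  · rintro (rfl | rfl | rfl)
    exacts [⟨0, rfl⟩, ⟨1, rfl⟩, ⟨2, rfl⟩]

/-- The Gram determinant of three vectors of `ℝ³` is the square of the determinant of their
coordinate matrix (`det (M Mᵀ) = (det M)²`). [folklore] -/
theorem det_gram_eq_det_sq (u v w : EuclideanSpace ℝ (Fin 3)) :
    Matrix.det !![‖u‖ ^ 2, ⟪u, v⟫_ℝ, ⟪u, w⟫_ℝ; ⟪u, v⟫_ℝ, ‖v‖ ^ 2, ⟪v, w⟫_ℝ;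
        ⟪u, w⟫_ℝ, ⟪v, w⟫_ℝ, ‖w‖ ^ 2] =
      (Matrix.det (Matrix.of fun i j => (![u, v, w] i) j)) ^ 2 := by
  have hi : ∀ x y : EuclideanSpace ℝ (Fin 3), ⟪x, y⟫_ℝ = x 0 * y 0 + x 1 * y 1 + x 2 * y 2 := by
    intro x y
    simp [PiLp.inner_apply, Fin.sum_univ_three, mul_comm]
  have hn : ∀ x : EuclideanSpace ℝ (Fin 3), ‖x‖ ^ 2 = x 0 * x 0 + x 1 * x 1 + x 2 * x 2 := by
    intro x
    rw [← real_inner_self_eq_norm_sq, hi]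
  rw [det_symm_fin_three, Matrix.det_fin_three]
  simp only [Matrix.of_apply, Matrix.cons_val_zero, Matrix.cons_val_one, Matrix.cons_val_two,
    Matrix.head_cons, Matrix.tail_cons, hn, hi]
  ring

variable (L : Submodule ℤ (EuclideanSpace ℝ (Fin 3))) [DiscreteTopology L] [IsZLattice ℝ L]

/-- A generating triple of a full lattice of `ℝ³` is `ℝ`-linearly independent (three vectors
spanning a `3`-dimensional space). [folklore] -/
theorem linearIndependent_of_span_triple_eq {u v w : EuclideanSpace ℝ (Fin 3)}
    (h : span ℤ ({u, v, w} : Set (EuclideanSpace ℝ (Fin 3))) = L) :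
    LinearIndependent ℝ ![u, v, w] := by
  refine linearIndependent_of_top_le_span_of_card_eq_finrank ?_ (by simp)
  rw [range_vec_three, ← Submodule.span_span_of_tower ℤ ℝ, h, IsZLattice.span_top]

/-- **The Gram determinant of a basis is the squared covolume** (Conway–Sloane Ch. 1 §1.4:
`det Λ = det A = (det M)²` for a generator matrix `M` with Gram matrix `A = M Mᵀ`), for a
generating triple of a full lattice of `ℝ³`. [cite: ConwaySloane1999, Ch. 1 §1.4] -/
theorem det_gram_eq_covolume_sq {u v w : EuclideanSpace ℝ (Fin 3)}
    (h : span ℤ ({u, v, w} : Set (EuclideanSpace ℝ (Fin 3))) = L) :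
    Matrix.det !![‖u‖ ^ 2, ⟪u, v⟫_ℝ, ⟪u, w⟫_ℝ; ⟪u, v⟫_ℝ, ‖v‖ ^ 2, ⟪v, w⟫_ℝ;
        ⟪u, w⟫_ℝ, ⟪v, w⟫_ℝ, ‖w‖ ^ 2] = ZLattice.covolume L ^ 2 := by
  have hli := linearIndependent_of_span_triple_eq L h
  have htop : ⊤ ≤ span ℝ (Set.range ![u, v, w]) := by
    rw [range_vec_three, ← Submodule.span_span_of_tower ℤ ℝ, h, IsZLattice.span_top]
  let b : Basis (Fin 3) ℝ (EuclideanSpace ℝ (Fin 3)) := Basis.mk hli htop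
  have hb : ⇑b = ![u, v, w] := Basis.coe_mk _ _
  have hL : L = span ℤ (Set.range ⇑b) := by rw [hb, range_vec_three, h]
  rw [hL, covolume_span_eq_abs_det b, sq_abs, det_gram_eq_det_sq, hb]

/-- **Gauss's theorem, `γ₃ ≤ 2^{1/3}`** (Cassels Ch. II §3.4, Theorem III.A; Conway–Sloane
Ch. 1 §1.4, Table 1.2): if every nonzero vector of a full lattice `L ⊂ ℝ³` has squared length at
least `m ≥ 0`, then `m³ ≤ 2 covol(L)²` (equivalently `λ₁(L)² ≤ 2^{1/3} covol(L)^{2/3}`). Proof: a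
Minkowski-reduced basis `(u, v, w)` has `m ≤ ‖u‖² ≤ ‖v‖² ≤ ‖w‖²` and
`‖u‖²‖v‖²‖w‖² ≤ 2 det Gram = 2 covol²`. [cite: Cassels1997, Ch. II §3.4 Theorem III] -/
theorem pow_three_le_two_mul_covolume_sq {m : ℝ} (hm : 0 ≤ m)
    (hmin : ∀ x ∈ L, x ≠ 0 → m ≤ ‖x‖ ^ 2) : m ^ 3 ≤ 2 * ZLattice.covolume L ^ 2 := by
  obtain ⟨u, v, w, hred⟩ := exists_isMinkowskiReduced_of_finrank_eq L (by simp)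
  have hG := hred.prod_le_two_mul_det.1
  rw [det_gram_eq_covolume_sq L hred.span_eq] at hG
  have hu0 : u ≠ 0 := by
    have := (linearIndependent_of_span_triple_eq L hred.span_eq).ne_zero 0
    simpa using this
  have hmu : m ≤ ‖u‖ ^ 2 := hmin u (hred.span_eq ▸ mem_span_triple₁ u v w) hu0
  have h₁₂ : ‖u‖ ^ 2 ≤ ‖v‖ ^ 2 := pow_le_pow_left₀ (norm_nonneg _) hred.norm_le₁₂ 2
  have h₂₃ : ‖v‖ ^ 2 ≤ ‖w‖ ^ 2 := pow_le_pow_left₀ (norm_nonneg _) hred.norm_le₂₃ 2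
  have hmv : m ≤ ‖v‖ ^ 2 := hmu.trans h₁₂
  have hmw : m ≤ ‖w‖ ^ 2 := hmv.trans h₂₃
  have h3 : m ^ 3 ≤ ‖u‖ ^ 2 * ‖v‖ ^ 2 * ‖w‖ ^ 2 :=
    calc m ^ 3 = m * m * m := by ring
      _ ≤ ‖u‖ ^ 2 * ‖v‖ ^ 2 * ‖w‖ ^ 2 :=
        mul_le_mul (mul_le_mul hmu hmv hm (sq_nonneg _)) hmw hm (by positivity)
  exact h3.trans hG

/-- **Rigidity in Gauss's theorem: extremal lattices have a short dual vector** (Cassels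
Ch. II §3.4, Theorem III.C, first step, combined with the dual basis, Conway–Sloane Ch. 1 §1.5):
if every nonzero vector of the full lattice `L ⊂ ℝ³` has `‖x‖² ≥ m > 0` and `2 covol(L)² ≤ m³`
(so `L` is extremal, `m³ = 2 covol²`), then a Minkowski-reduced basis has all three squared
lengths `m` and some `|⟪vⱼ, v_k⟫| = m/2`, and the corresponding dual-basis vector `z ∈ L*`
satisfies `z ≠ 0` and `‖z‖² covol(L)² = m² - (m/2)² = ¾ m²` (for the fcc lattice: the dual bcc
lattice at the dual scale). [cite: Cassels1997, Ch. II §3.4 Theorem III] -/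
theorem exists_mem_dualLattice_norm_sq_eq_of_extremal {m : ℝ} (hm : 0 < m)
    (hmin : ∀ x ∈ L, x ≠ 0 → m ≤ ‖x‖ ^ 2) (hext : 2 * ZLattice.covolume L ^ 2 ≤ m ^ 3) :
    ∃ z ∈ dualLattice L, z ≠ 0 ∧ ‖z‖ ^ 2 * ZLattice.covolume L ^ 2 = 3 / 4 * m ^ 2 := by
  obtain ⟨u, v, w, hred⟩ := exists_isMinkowskiReduced_of_finrank_eq L (by simp)
  obtain ⟨hG, hrig⟩ := hred.prod_le_two_mul_det
  have hdet := det_gram_eq_covolume_sq L hred.span_eq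
  rw [hdet] at hG hrig
  have hcov : 0 < ZLattice.covolume L := ZLattice.covolume_pos L volume
  have hu0 : u ≠ 0 := by
    have := (linearIndependent_of_span_triple_eq L hred.span_eq).ne_zero 0
    simpa using this
  have hmu : m ≤ ‖u‖ ^ 2 := hmin u (hred.span_eq ▸ mem_span_triple₁ u v w) hu0
  have h₁₂ : ‖u‖ ^ 2 ≤ ‖v‖ ^ 2 := pow_le_pow_left₀ (norm_nonneg _) hred.norm_le₁₂ 2
  have h₂₃ : ‖v‖ ^ 2 ≤ ‖w‖ ^ 2 := pow_le_pow_left₀ (norm_nonneg _) hred.norm_le₂₃ 2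
  -- all three squared norms equal `m`
  have hw_le : ‖w‖ ^ 2 ≤ m := by
    by_contra hlt
    push Not at hlt
    have : m ^ 3 < ‖u‖ ^ 2 * ‖v‖ ^ 2 * ‖w‖ ^ 2 := by
      calc m ^ 3 = m * m * m := by ring
        _ < m * m * ‖w‖ ^ 2 := by gcongr
        _ ≤ ‖u‖ ^ 2 * ‖v‖ ^ 2 * ‖w‖ ^ 2 := by
          apply mul_le_mul_of_nonneg_right (mul_le_mul hmu (hmu.trans h₁₂) hm.le (sq_nonneg _))
            (sq_nonneg _)
    linarith
  have hNu : ‖u‖ ^ 2 = m := le_antisymm (h₁₂.trans (h₂₃.trans hw_le)) hmu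
  have hNv : ‖v‖ ^ 2 = m := le_antisymm (h₂₃.trans hw_le) (hmu.trans h₁₂)
  have hNw : ‖w‖ ^ 2 = m := le_antisymm hw_le ((hmu.trans h₁₂).trans h₂₃)
  have hprod : ‖u‖ ^ 2 * ‖v‖ ^ 2 * ‖w‖ ^ 2 = m ^ 3 := by rw [hNu, hNv, hNw]; ring
  have hcases := hrig (by linarith) (by rw [hNu, hNw])
  have hcovsq : ZLattice.covolume L ^ 2 = m ^ 3 / 2 := by nlinarith
  -- in each case, a dual-basis vector built from cofactors
  have key : ∀ {a b c : EuclideanSpace ℝ (Fin 3)},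
      span ℤ ({a, b, c} : Set (EuclideanSpace ℝ (Fin 3))) = L →
      ‖b‖ ^ 2 = m → ‖c‖ ^ 2 = m → 2 * |⟪b, c⟫_ℝ| = m →
      ∃ z ∈ dualLattice L, z ≠ 0 ∧ ‖z‖ ^ 2 * ZLattice.covolume L ^ 2 = 3 / 4 * m ^ 2 := by
    intro a b c habc hb hc hbc
    have hdet' := det_gram_eq_covolume_sq L habc
    have hD : Matrix.det !![‖a‖ ^ 2, ⟪a, b⟫_ℝ, ⟪a, c⟫_ℝ; ⟪a, b⟫_ℝ, ‖b‖ ^ 2, ⟪b, c⟫_ℝ;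
        ⟪a, c⟫_ℝ, ⟪b, c⟫_ℝ, ‖c‖ ^ 2] ≠ 0 := by
      rw [hdet']; positivity
    obtain ⟨z, hz, hz₁, hzn⟩ := exists_mem_dualLattice_inner_eq_one L habc hD
    refine ⟨z, hz, fun h0 => by simp [h0] at hz₁, ?_⟩
    rw [hzn, hdet', div_mul_cancel₀ _ (by positivity), hb, hc]
    have habs : ⟪b, c⟫_ℝ ^ 2 = (m / 2) ^ 2 := by
      rw [← sq_abs, show |⟪b, c⟫_ℝ| = m / 2 by linarith]
    rw [habs]; ring
  rcases hcases with huv | huw | hvw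
  · -- pair (u, v): use the triple (w, u, v)
    refine key (a := w) (b := u) (c := v) ?_ hNu hNv (by rw [huv, hNu])
    rw [span_triple_comm₁₂, span_triple_comm₂₃]; exact hred.span_eq
  · -- pair (u, w): use the triple (v, u, w)
    refine key (a := v) (b := u) (c := w) ?_ hNu hNw (by rw [huw, hNu])
    rw [span_triple_comm₁₂]; exact hred.span_eq
  · -- pair (v, w): use the triple (u, v, w)
    exact key hred.span_eq hNv hNw (by rw [hvw, hNu])

end Euclidean

end Literature.Algebra.EuclideanLattices
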